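import Mathlib
import Summits.ValiantsHypothesis.ValiantsHypothesis.Theorems.NewtonUnitEquationsNewtonTauWeakResidueNormalForm

/-!
# `NewtonUnitEquationsNewtonTauWeakMarkedSwitchNormalForm` — switch normal form for marked letters

Rung toward THEOREM G′ of line `binomial-normal-form` (crux `NewtonTauWeak`, stmt-ValiantsHypothesis-5904, lead c5):
registered stub `stub_markedSwitchNormalForm`.  Factors `j : Fin m` carry letter sets `A j`, marks `μ j a ∈ {0, 1}`
and heights `c` (injective on every `A j`); a word `a` (`a j ∈ A j`) is *admissible* if `Σ_j μ j (a j) ≡ r (mod q)`.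
Let `τ_j` be the top letter of `A j`, `t_j := μ j τ_j` its *type*; `j` is *switchable* if `A j` has a letter of mark
`≠ t_j`, `τ'_j` is then the highest one and `loss_j := c τ_j - c τ'_j > 0`.  Claim: a maximal admissible word `a₀`
has the height of an admissible word of SPECIAL FORM (tops off a set `S` of switchable factors, `τ'_j` on `S`, fewer
than `q` factors of `S` of either type, `(loss_j, j) <lex (loss_{j'}, j')` for `j ∈ S`, `j' ∉ S` switchable alike).
Proof (exchange argument).  (i) Replacing every letter of `a₀` by the best letter of its own mark gives the word
`w(S₀)` switched exactly on `S₀ := {j : μ j (a₀ j) ≠ t_j}`: same marks, height `≥`.  (ii) `n_τ := |S₀ ∩ type τ| < q`: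
otherwise un-switch `q` of them — the mark sum moves by `∓ q`, the height grows by `q` losses `> 0`, contradiction.
(iii) `S ∩ type τ` := the `n_τ` switchable factors of type `τ` of least rank for the key `(loss, index)` (the rank
is a bijection onto `{0, …, |class| - 1}`, `ResidueNormalFormAux.card_filter_rank_lt`); equal switch counts per type give
equal mark sums, so `w(S)` is admissible, and a down-set has least total loss among subsets of its size
(`ResidueNormalFormAux.sum_filter_rank_lt_le`), so `height(w S) ≥ height(w S₀) ≥ height(a₀)`: equality by maximality.
(iv) The properties of `w(S)` are read off (`c x = c τ_j`, `c x' = c τ'_{j'}` are pinned; ranks are monotone in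
the key).  [folklore: exchange argument]
-/

set_option linter.dupNamespace false

noncomputable section

open scoped BigOperators

namespace Summit.ValiantsHypothesis.ValiantsHypothesis.Theorems.NewtonUnitEquationsNewtonTauWeak

namespace MarkedSwitchAux

variable {L : Type*}

/-! The rank toolkit for the lexicographic key `(loss, index)` — totality, strict monotonicity of the rank,
`card_filter_rank_lt` (exactly `n` elements have rank `< n`) and `sum_filter_rank_lt_le` (down-sets are cheapest) —
is `ResidueNormalFormAux.*` of the sibling rung `…ResidueNormalForm` (imported). -/

/-- Height of a switched word: switching the factors in `T` from `top` to `alt` costs the losses of `T`. [folklore] -/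
theorem value_switch {m : ℕ} (c : L → ℝ) (top alt w : Fin m → L) (T : Finset (Fin m))
    (hw1 : ∀ j ∈ T, w j = alt j) (hw2 : ∀ j ∉ T, w j = top j) (loss : Fin m → ℝ)
    (hloss : ∀ j, loss j = c (top j) - c (alt j)) : ∑ j, c (w j) + ∑ j ∈ T, loss j = ∑ j, c (top j) := by
  have h : ∑ j ∈ T, loss j = ∑ j, if j ∈ T then loss j else 0 := by rw [Finset.sum_ite_mem, Finset.univ_inter]
  rw [h, ← Finset.sum_add_distrib]
  refine Finset.sum_congr rfl fun j _ => ?_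
  by_cases hj : j ∈ T
  · rw [hw1 j hj, if_pos hj, hloss]; ring
  · rw [hw2 j hj, if_neg hj, add_zero]

/-- Mark sum of a switched word with `0/1` marks: if on `T` the marks of `alt` and `top` are complementary, then
`Σ_j μ (w j) + |T ∩ {top-mark 1}| = Σ_j μ (top j) + |T ∩ {top-mark 0}|`. [folklore] -/
theorem mark_switch {m : ℕ} (μ : Fin m → L → ℕ) (top alt w : Fin m → L) (T : Finset (Fin m))
    (hw1 : ∀ j ∈ T, w j = alt j) (hw2 : ∀ j ∉ T, w j = top j)
    (hT : ∀ j ∈ T, μ j (alt j) + μ j (top j) = 1) (htop1 : ∀ j, μ j (top j) ≤ 1) :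
    ∑ j, μ j (w j) + (T.filter fun j => μ j (top j) = 1).card =
      ∑ j, μ j (top j) + (T.filter fun j => μ j (top j) = 0).card := by
  have h1 : (T.filter fun j => μ j (top j) = 1).card = ∑ j, if j ∈ T then μ j (top j) else 0 := by
    rw [Finset.card_filter, Finset.sum_ite_mem, Finset.univ_inter]
    exact Finset.sum_congr rfl fun j _ => by have := htop1 j; split_ifs with h <;> omega
  have h0 : (T.filter fun j => μ j (top j) = 0).card = ∑ j, if j ∈ T then 1 - μ j (top j) else 0 := by
    rw [Finset.card_filter, Finset.sum_ite_mem, Finset.univ_inter]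
    exact Finset.sum_congr rfl fun j _ => by have := htop1 j; split_ifs with h <;> omega
  rw [h1, h0, ← Finset.sum_add_distrib, ← Finset.sum_add_distrib]
  refine Finset.sum_congr rfl fun j _ => ?_
  by_cases hj : j ∈ T
  · rw [hw1 j hj, if_pos hj, if_pos hj]; have := hT j hj; omega
  · rw [hw2 j hj, if_neg hj, if_neg hj]

/-- **Switch normal form, abstract data.**  The statement of `stub_markedSwitchNormalForm` with the top letters
`top j` (a highest letter of `A j`) and the best opposite letters `alt j` (a highest letter of `A j` of mark
`≠ μ j (top j)`, whenever there is one) supplied as parameters. [folklore: exchange argument] -/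
theorem normalForm_of_data (m q r : ℕ) (hq : 1 ≤ q) (A : Fin m → Finset L) (μ : Fin m → L → ℕ)
    (hμ : ∀ j a, μ j a ≤ 1) (c : L → ℝ) (hc : ∀ j, Set.InjOn c (A j : Set L)) (a₀ : Fin m → L)
    (ha₀ : ∀ j, a₀ j ∈ A j) (hadm : (∑ j, μ j (a₀ j)) % q = r % q)
    (hmax : ∀ a : Fin m → L, (∀ j, a j ∈ A j) → (∑ j, μ j (a j)) % q = r % q → ∑ j, c (a j) ≤ ∑ j, c (a₀ j))
    (top alt : Fin m → L) (htop : ∀ j, top j ∈ A j) (htopmax : ∀ j, ∀ y ∈ A j, c y ≤ c (top j))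
    (halt : ∀ j, alt j ∈ A j) (haltspec : ∀ j, (∃ x ∈ A j, μ j x ≠ μ j (top j)) →
      μ j (alt j) ≠ μ j (top j) ∧ ∀ y ∈ A j, μ j y ≠ μ j (top j) → c y ≤ c (alt j)) :
    ∃ (a : Fin m → L) (S : Finset (Fin m)),
      (∀ j, a j ∈ A j) ∧ (∑ j, μ j (a j)) % q = r % q ∧ ∑ j, c (a j) = ∑ j, c (a₀ j) ∧
      (∀ j, j ∉ S → ∀ x ∈ A j, c x ≤ c (a j)) ∧
      (∀ j ∈ S, (∀ y ∈ A j, μ j y = μ j (a j) → c y ≤ c (a j)) ∧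
        ∃ x ∈ A j, μ j x ≠ μ j (a j) ∧ ∀ y ∈ A j, c y ≤ c x) ∧
      (S.filter fun j => μ j (a j) = 0).card < q ∧ (S.filter fun j => μ j (a j) = 1).card < q ∧
      (∀ j ∈ S, ∀ j', j' ∉ S → (∀ y ∈ A j', c y ≤ c (a j')) → μ j' (a j') ≠ μ j (a j) →
        ∀ x ∈ A j, (∀ y ∈ A j, c y ≤ c x) →
        ∀ x' ∈ A j', μ j' x' ≠ μ j' (a j') → (∀ y' ∈ A j', μ j' y' ≠ μ j' (a j') → c y' ≤ c x') →
          (c x - c (a j) < c (a j') - c x' ∨ (c x - c (a j) = c (a j') - c x' ∧ j < j'))) := by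
  -- the switchable factors `W`, the losses, and their basic properties
  obtain ⟨W, hW⟩ : ∃ W : Finset (Fin m), ∀ j, j ∈ W ↔ ∃ x ∈ A j, μ j x ≠ μ j (top j) :=
    ⟨Finset.univ.filter fun j => ∃ x ∈ A j, μ j x ≠ μ j (top j),
      fun j => Finset.mem_filter.trans (and_iff_right (Finset.mem_univ _))⟩
  obtain ⟨loss, hloss⟩ : ∃ loss : Fin m → ℝ, ∀ j, loss j = c (top j) - c (alt j) := ⟨_, fun _ => rfl⟩
  have top_le : ∀ j, μ j (top j) ≤ 1 := fun j => hμ j (top j)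
  have alt_ne : ∀ j ∈ W, μ j (alt j) ≠ μ j (top j) := fun j hj => (haltspec j ((hW j).1 hj)).1
  have alt_max : ∀ j ∈ W, ∀ y ∈ A j, μ j y ≠ μ j (top j) → c y ≤ c (alt j) :=
    fun j hj => (haltspec j ((hW j).1 hj)).2
  have alt_add : ∀ j ∈ W, μ j (alt j) + μ j (top j) = 1 := fun j hj => by
    have h1 := alt_ne j hj; have h2 := hμ j (alt j); have h3 := top_le j; omega
  have loss_pos : ∀ j ∈ W, 0 < loss j := fun j hj => by
    rw [hloss]
    refine sub_pos.2 (lt_of_le_of_ne (htopmax j (alt j) (halt j)) fun h => ?_)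
    exact alt_ne j hj (congrArg (μ j) (hc j (halt j) (htop j) h))
  -- the word switched exactly on `T`: letters, height, mark sum
  obtain ⟨w, hw1, hw2⟩ : ∃ w : Finset (Fin m) → Fin m → L,
      (∀ T, ∀ j ∈ T, w T j = alt j) ∧ (∀ T, ∀ j ∉ T, w T j = top j) :=
    ⟨fun T j => if j ∈ T then alt j else top j, fun T j hj => if_pos hj, fun T j hj => if_neg hj⟩
  have w_mem : ∀ T j, w T j ∈ A j := fun T j => by
    by_cases hj : j ∈ T
    · rw [hw1 T j hj]; exact halt j
    · rw [hw2 T j hj]; exact htop j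
  have w_val : ∀ T, ∑ j, c (w T j) + ∑ j ∈ T, loss j = ∑ j, c (top j) :=
    fun T => value_switch c top alt (w T) T (hw1 T) (hw2 T) loss hloss
  have w_mark : ∀ T, T ⊆ W → ∑ j, μ j (w T j) + (T.filter fun j => μ j (top j) = 1).card =
      ∑ j, μ j (top j) + (T.filter fun j => μ j (top j) = 0).card :=
    fun T hT => mark_switch μ top alt (w T) T (hw1 T) (hw2 T) (fun j hj => alt_add j (hT hj)) top_le
  -- (i) `S₀`: the switched factors of `a₀`; `w S₀` has the marks of `a₀` and is at least as high
  obtain ⟨S₀, hS₀⟩ : ∃ S₀ : Finset (Fin m), ∀ j, j ∈ S₀ ↔ μ j (a₀ j) ≠ μ j (top j) :=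
    ⟨Finset.univ.filter fun j => μ j (a₀ j) ≠ μ j (top j),
      fun j => Finset.mem_filter.trans (and_iff_right (Finset.mem_univ _))⟩
  have S₀W : S₀ ⊆ W := fun j hj => (hW j).2 ⟨a₀ j, ha₀ j, (hS₀ j).1 hj⟩
  have a₀_w : ∀ j, μ j (a₀ j) = μ j (w S₀ j) ∧ c (a₀ j) ≤ c (w S₀ j) := fun j => by
    by_cases hj : j ∈ S₀
    · rw [hw1 S₀ j hj]
      have h1 := (hS₀ j).1 hj; have h2 := alt_add j (S₀W hj); have h3 := hμ j (a₀ j)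
      exact ⟨by omega, alt_max j (S₀W hj) (a₀ j) (ha₀ j) h1⟩
    · rw [hw2 S₀ j hj]
      exact ⟨by by_contra h; exact hj ((hS₀ j).2 h), htopmax j (a₀ j) (ha₀ j)⟩
  have S₀_adm : (∑ j, μ j (w S₀ j)) % q = r % q := by
    rw [Finset.sum_congr rfl fun j _ => (a₀_w j).1.symm]; exact hadm
  have S₀_val : ∑ j, c (a₀ j) ≤ ∑ j, c (w S₀ j) := Finset.sum_le_sum fun j _ => (a₀_w j).2
  -- (ii) the number `n τ` of switches of type `τ` is `< q`, else un-switch `q` of them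
  obtain ⟨n, hn⟩ : ∃ n : ℕ → ℕ, ∀ τ, n τ = (S₀.filter fun j => μ j (top j) = τ).card := ⟨_, fun _ => rfl⟩
  have n_lt : ∀ τ, τ ≤ 1 → n τ < q := by
    intro τ hτ
    by_contra hge
    rw [not_lt, hn] at hge
    obtain ⟨E, hEsub, hEcard⟩ := Finset.exists_subset_card_eq hge
    have hES₀ : E ⊆ S₀ := fun j hj => (Finset.mem_filter.1 (hEsub hj)).1
    have hEτ : ∀ j ∈ E, μ j (top j) = τ := fun j hj => (Finset.mem_filter.1 (hEsub hj)).2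
    have hsplit : ∀ σ, ((S₀ \ E).filter fun j => μ j (top j) = σ).card +
        (E.filter fun j => μ j (top j) = σ).card = (S₀.filter fun j => μ j (top j) = σ).card := fun σ => by
      rw [← Finset.card_union_of_disjoint (Finset.disjoint_filter_filter Finset.sdiff_disjoint),
        ← Finset.filter_union, Finset.sdiff_union_of_subset hES₀]
    have hEσ : ∀ σ, σ ≠ τ → (E.filter fun j => μ j (top j) = σ).card = 0 := fun σ hσ =>
      Finset.card_eq_zero.2 (Finset.filter_false_of_mem fun j hj h => hσ (h.symm.trans (hEτ j hj)))
    have hEτ' : (E.filter fun j => μ j (top j) = τ).card = q := by rw [Finset.filter_true_of_mem hEτ, hEcard]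
    have hmS := w_mark S₀ S₀W; have hmT := w_mark (S₀ \ E) fun j hj => S₀W (Finset.mem_sdiff.1 hj).1
    have h0 := hsplit 0; have h1 := hsplit 1
    have hmod : (∑ j, μ j (w (S₀ \ E) j)) % q = r % q := by
      rw [← S₀_adm]
      obtain rfl | rfl : τ = 0 ∨ τ = 1 := by omega
      · rw [hEτ'] at h0; rw [hEσ 1 (by norm_num)] at h1
        have key : ∑ j, μ j (w S₀ j) = ∑ j, μ j (w (S₀ \ E) j) + q := by omega
        rw [key, Nat.add_mod_right]
      · rw [hEσ 0 (by norm_num)] at h0; rw [hEτ'] at h1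
        have key : ∑ j, μ j (w (S₀ \ E) j) = ∑ j, μ j (w S₀ j) + q := by omega
        rw [key, Nat.add_mod_right]
    have hle := hmax _ (w_mem (S₀ \ E)) hmod
    have hvS := w_val S₀; have hvT := w_val (S₀ \ E); have hsd := Finset.sum_sdiff (f := loss) hES₀
    have hpos : 0 < ∑ j ∈ E, loss j :=
      Finset.sum_pos (fun j hj => loss_pos j (S₀W (hES₀ hj))) (Finset.card_pos.1 (by rw [hEcard]; exact hq))
    linarith
  -- (iii) the classes `C τ` of switchable factors of type `τ`, and the target set `S`
  obtain ⟨C, hC⟩ : ∃ C : ℕ → Finset (Fin m), ∀ τ j, j ∈ C τ ↔ j ∈ W ∧ μ j (top j) = τ :=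
    ⟨fun τ => W.filter fun j => μ j (top j) = τ, fun τ j => Finset.mem_filter⟩
  have S₀C : ∀ τ, (S₀.filter fun j => μ j (top j) = τ) ⊆ C τ := fun τ j hj =>
    (hC τ j).2 ⟨S₀W (Finset.mem_filter.1 hj).1, (Finset.mem_filter.1 hj).2⟩
  have n_le : ∀ τ, n τ ≤ (C τ).card := fun τ => (hn τ).trans_le (Finset.card_le_card (S₀C τ))
  obtain ⟨S, hS⟩ : ∃ S : Finset (Fin m), ∀ j, j ∈ S ↔ j ∈ W ∧
      ((C (μ j (top j))).filter fun z => loss z < loss j ∨ (loss z = loss j ∧ z < j)).card < n (μ j (top j)) :=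
    ⟨Finset.univ.filter fun j => j ∈ W ∧
      ((C (μ j (top j))).filter fun z => loss z < loss j ∨ (loss z = loss j ∧ z < j)).card < n (μ j (top j)),
      fun j => Finset.mem_filter.trans (and_iff_right (Finset.mem_univ _))⟩
  have SW : S ⊆ W := fun j hj => ((hS j).1 hj).1
  have S_fiber : ∀ τ, (S.filter fun j => μ j (top j) = τ) =
      (C τ).filter fun x => ((C τ).filter fun z => loss z < loss x ∨ (loss z = loss x ∧ z < x)).card < n τ := by
    intro τ
    ext j
    simp only [Finset.mem_filter, hS, hC]
    exact ⟨fun ⟨⟨hjW, hlt⟩, hjτ⟩ => by subst hjτ; exact ⟨⟨hjW, rfl⟩, hlt⟩,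
      fun ⟨⟨hjW, hjτ⟩, hlt⟩ => by subst hjτ; exact ⟨⟨hjW, hlt⟩, rfl⟩⟩
  have S_card : ∀ τ, (S.filter fun j => μ j (top j) = τ).card = n τ := fun τ => by
    rw [S_fiber]; exact ResidueNormalFormAux.card_filter_rank_lt (C τ) loss (n_le τ)
  have S_loss : ∀ τ, ∑ j ∈ S.filter (fun j => μ j (top j) = τ), loss j ≤
      ∑ j ∈ S₀.filter (fun j => μ j (top j) = τ), loss j := fun τ => by
    rw [S_fiber, hn]; exact ResidueNormalFormAux.sum_filter_rank_lt_le (C τ) loss (S₀C τ)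
  -- summing over the two types: `w S` is admissible and at least as high as `w S₀`, hence optimal
  have maps : ∀ T : Finset (Fin m), ∀ j ∈ T, μ j (top j) ∈ Finset.range 2 :=
    fun T j _ => Finset.mem_range.2 (Nat.lt_succ_of_le (top_le j))
  have loss_le : ∑ j ∈ S, loss j ≤ ∑ j ∈ S₀, loss j :=
    calc ∑ j ∈ S, loss j = ∑ τ ∈ Finset.range 2, ∑ j ∈ S.filter (fun j => μ j (top j) = τ), loss j :=
          (Finset.sum_fiberwise_of_maps_to (maps S) loss).symm
      _ ≤ ∑ τ ∈ Finset.range 2, ∑ j ∈ S₀.filter (fun j => μ j (top j) = τ), loss j :=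
          Finset.sum_le_sum fun τ _ => S_loss τ
      _ = ∑ j ∈ S₀, loss j := Finset.sum_fiberwise_of_maps_to (maps S₀) loss
  have S_adm : (∑ j, μ j (w S j)) % q = r % q := by
    have key : ∑ j, μ j (w S j) = ∑ j, μ j (w S₀ j) := by
      have h1 := w_mark S SW; have h2 := w_mark S₀ S₀W
      have h3 := S_card 0; have h4 := S_card 1; have h5 := hn 0; have h6 := hn 1
      omega
    rw [key]; exact S₀_adm
  have S_val : ∑ j, c (w S j) = ∑ j, c (a₀ j) := by
    refine le_antisymm (hmax _ (w_mem S) S_adm) ?_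
    have hvS := w_val S; have hv0 := w_val S₀
    linarith
  -- on `S` the letter of `w S` has the mark opposite to the type
  have S_mark_alt : ∀ j ∈ S, μ j (w S j) + μ j (top j) = 1 := fun j hj => by
    rw [hw1 S j hj]; exact alt_add j (SW hj)
  have filt0 : (S.filter fun j => μ j (w S j) = 0) = S.filter fun j => μ j (top j) = 1 :=
    Finset.filter_congr fun j hj => by have := S_mark_alt j hj; omega
  have filt1 : (S.filter fun j => μ j (w S j) = 1) = S.filter fun j => μ j (top j) = 0 :=
    Finset.filter_congr fun j hj => by have := S_mark_alt j hj; omega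
  -- (iv) assemble
  refine ⟨w S, S, w_mem S, S_adm, S_val, fun j hj x hx => ?_, fun j hj => ?_, ?_, ?_, ?_⟩
  · rw [hw2 S j hj]; exact htopmax j x hx
  · have hjW := SW hj
    rw [hw1 S j hj]
    refine ⟨fun y hy hμy => alt_max j hjW y hy ?_, top j, htop j, (alt_ne j hjW).symm, htopmax j⟩
    rw [hμy]; exact alt_ne j hjW
  · rw [filt0, S_card 1]; exact n_lt 1 le_rfl
  · rw [filt1, S_card 0]; exact n_lt 0 zero_le_one
  · intro j hj j' hj' _htop' hne x hx hxmax x' hx' hx'ne hx'max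
    have hjW := SW hj
    rw [hw1 S j hj] at hne ⊢
    rw [hw2 S j' hj'] at hne hx'ne hx'max ⊢
    -- `j` and `j'` have the same type; `x` is as high as `top j`, `x'` as high as `alt j'`
    have htt : μ j' (top j') = μ j (top j) := by have h1 := alt_add j hjW; have h2 := top_le j'; omega
    have hj'W : j' ∈ W := (hW j').2 ⟨x', hx', hx'ne⟩
    have hcx : c x = c (top j) := le_antisymm (htopmax j x hx) (hxmax (top j) (htop j))
    have hcx' : c x' = c (alt j') :=
      le_antisymm (alt_max j' hj'W x' hx' hx'ne) (hx'max (alt j') (halt j') (alt_ne j' hj'W))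
    have e1 : c x - c (alt j) = loss j := by rw [hcx, hloss]
    have e2 : c (top j') - c x' = loss j' := by rw [hcx', hloss]
    rw [e1, e2]
    -- ranks: `j ∈ S` has rank `< n`, the switchable `j' ∉ S` of the same class has rank `≥ n`
    have hrj := ((hS j).1 hj).2
    have hrj' : ¬ ((C (μ j (top j))).filter
        fun z => loss z < loss j' ∨ (loss z = loss j' ∧ z < j')).card < n (μ j (top j)) := fun h => by
      rw [← htt] at h
      exact hj' ((hS j').2 ⟨hj'W, h⟩)
    have hj'C : j' ∈ C (μ j (top j)) := (hC _ j').2 ⟨hj'W, htt⟩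
    have hne' : j ≠ j' := by rintro rfl; exact hj' hj
    rcases ResidueNormalFormAux.key_total loss hne' with h | h
    · exact h
    · exact absurd ((ResidueNormalFormAux.rank_lt_rank (C (μ j (top j))) loss hj'C h).trans hrj) hrj'

end MarkedSwitchAux

/-- **Switch normal form of a residue-constrained maximiser over marked letters** (THEOREM G′ of line
`binomial-normal-form`: the marked-letter / t-nomial analogue of the exchange normal form).  Factors `j : Fin m` have
letter sets `A j`, `0/1` marks `μ j` and heights `c` injective on each `A j`; words `a` (`a j ∈ A j`) are admissible
if `Σ_j μ j (a j) ≡ r (mod q)`.  A maximal admissible word `a₀` has the height of an admissible word `a` such that,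
for some set `S` of factors: off `S` the word takes top letters; on `S` it takes the highest letter of its own mark
while the top letter has the other mark; fewer than `q` factors of `S` carry a letter of mark `0`, fewer than `q` one
of mark `1`; and for `j ∈ S`, `j' ∉ S` with tops of the same type and `j'` switchable, `(loss_j, j) <lex
(loss_{j'}, j')` (`loss_j = c (top of A j) - c (a j)`, `loss_{j'} = c (a j') - c (best opposite letter of A j')`).
Proof: `MarkedSwitchAux.normalForm_of_data` after choosing tops and best opposite letters. [folklore] -/
theorem stub_markedSwitchNormalForm (m q r : ℕ) (hq : 1 ≤ q) (A : Fin m → Finset (Fin 2 →₀ ℕ))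
    (μ : Fin m → (Fin 2 →₀ ℕ) → ℕ) (hμ : ∀ j a, μ j a ≤ 1) (c : (Fin 2 →₀ ℕ) → ℝ)
    (hc : ∀ j, Set.InjOn c (A j : Set (Fin 2 →₀ ℕ)))
    (a₀ : Fin m → (Fin 2 →₀ ℕ)) (ha₀ : ∀ j, a₀ j ∈ A j) (hadm : (∑ j, μ j (a₀ j)) % q = r % q)
    (hmax : ∀ a : Fin m → (Fin 2 →₀ ℕ), (∀ j, a j ∈ A j) → (∑ j, μ j (a j)) % q = r % q →
      ∑ j, c (a j) ≤ ∑ j, c (a₀ j)) :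
    ∃ (a : Fin m → (Fin 2 →₀ ℕ)) (S : Finset (Fin m)),
      (∀ j, a j ∈ A j) ∧ (∑ j, μ j (a j)) % q = r % q ∧ ∑ j, c (a j) = ∑ j, c (a₀ j) ∧
      (∀ j, j ∉ S → ∀ x ∈ A j, c x ≤ c (a j)) ∧
      (∀ j ∈ S, (∀ y ∈ A j, μ j y = μ j (a j) → c y ≤ c (a j)) ∧
        ∃ x ∈ A j, μ j x ≠ μ j (a j) ∧ ∀ y ∈ A j, c y ≤ c x) ∧
      (S.filter fun j => μ j (a j) = 0).card < q ∧ (S.filter fun j => μ j (a j) = 1).card < q ∧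
      (∀ j ∈ S, ∀ j', j' ∉ S → (∀ y ∈ A j', c y ≤ c (a j')) →
        μ j' (a j') ≠ μ j (a j) →
        ∀ x ∈ A j, (∀ y ∈ A j, c y ≤ c x) →
        ∀ x' ∈ A j', μ j' x' ≠ μ j' (a j') → (∀ y' ∈ A j', μ j' y' ≠ μ j' (a j') → c y' ≤ c x') →
          (c x - c (a j) < c (a j') - c x' ∨ (c x - c (a j) = c (a j') - c x' ∧ j < j'))) := by
  -- tops: a highest letter of each `A j` (nonempty as `a₀ j ∈ A j`)
  have htopex : ∀ j, ∃ x ∈ A j, ∀ y ∈ A j, c y ≤ c x := fun j => Finset.exists_max_image (A j) c ⟨a₀ j, ha₀ j⟩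
  choose top htop htopmax using htopex
  -- best opposite letters: a highest letter of mark `≠ μ j (top j)`, when there is one
  have haltex : ∀ j, ∃ x ∈ A j, ((∃ z ∈ A j, μ j z ≠ μ j (top j)) →
      μ j x ≠ μ j (top j) ∧ ∀ y ∈ A j, μ j y ≠ μ j (top j) → c y ≤ c x) := by
    intro j
    by_cases h : ∃ z ∈ A j, μ j z ≠ μ j (top j)
    · have hne : ((A j).filter fun z => μ j z ≠ μ j (top j)).Nonempty := by
        obtain ⟨z, hz, hzne⟩ := h
        exact ⟨z, Finset.mem_filter.2 ⟨hz, hzne⟩⟩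
      obtain ⟨x, hx, hxmax⟩ := Finset.exists_max_image ((A j).filter fun z => μ j z ≠ μ j (top j)) c hne
      exact ⟨x, (Finset.mem_filter.1 hx).1, fun _ =>
        ⟨(Finset.mem_filter.1 hx).2, fun y hy hyne => hxmax y (Finset.mem_filter.2 ⟨hy, hyne⟩)⟩⟩
    · exact ⟨top j, htop j, fun h' => absurd h' h⟩
  choose alt halt haltspec using haltex
  exact MarkedSwitchAux.normalForm_of_data m q r hq A μ hμ c hc a₀ ha₀ hadm hmax top alt htop htopmax halt haltspec

end Summit.ValiantsHypothesis.ValiantsHypothesis.Theorems.NewtonUnitEquationsNewtonTauWeak
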